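import Literature.NumberTheory.Automorphic.Liu2021.Def411WeilCarriersDoublingUnique
import Literature.NumberTheory.GelbartRogawski1991.DoubledWeilRepresentationDetTwist
import Literature.NumberTheory.Automorphic.UnitaryGroupDualPairReindex
import HarnessLib

/-!
# Determinant twists of the splitting attached to `χ`: `ι_{χ·α̃} = ι_χ ⊗ (α ∘ det)`

Topic `NumberTheory/Automorphic/Liu2021`; namespace `Literature.NumberTheory.Automorphic.Liu2021.Def411WeilCarriersDoubling`.
KERNEL only: one plumbing definition (`pairDet`, the determinant of the big unitary group of the pair valued in `U(1)(𝔸)`)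
and proved theorems; no named fact, no `sorry`.

For a unitary Hecke character `χ` of the CM field `L` with `χ|_{𝕀_{L⁺}} = ε_{L/L⁺}` and a continuous unitary AUTOMORPHIC character
`α` of `U(1)(𝔸_{L⁺})` put `χ' := χ · α̃`, `α̃(d) = α(d / d̄)` (`GRConstruction.DoubledWeilDetTwist.ratioHecke`; again unitary with
`χ'|_{𝕀_{L⁺}} = ε`).  Then the [GelbartRogawski1991, Prop. 3.1.1]-compatible splitting attached to `χ'` by doubling
([HarrisKudlaSweet1996]'s `ι̃_{V,χ'}`, [Liu2021, App. D Step 2]'s `ι_μ` at `μ = χ'`) is the CENTRAL TWIST of the one attached to `χ`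
by the character `α ∘ det` of `G₁(𝔸) = U(𝕍)(𝔸_{L⁺})`:

* `chiSplitting_mul_ratioHecke` — `chiSplitting χ' = chiSplitting χ ⊗ (α ∘ det)` (`GRConstruction.IsDoubledWeilRep.detTwist` +
  `DoubledWeilDetTwist.undoubleHom_twist` + `chiSplitting_eq_undoubleHom`);
* `chiSplittingLine_mul_ratioHecke` — the same at the hermitian LINE `⟨T_W⟩` (the shape `OmegaMuSplitting.sMu` of the COR-CM displays
  is fed), with the twisting character written as `α ∘ pairDet` on `U(diag dV ⊗ J_W)(𝔸_{L⁺})`.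

This is the «distinct `μ` ↔ distinct splittings, `s ↦ s ⊗ ĉ`» direction of [GelbartRogawski1991, §3.1 Remark p. 457 L4–13] for the
dictionary `χ ↦ ι_χ`: moving `χ` along the automorphic characters of `U(1)` moves `ι_χ` along the central det-twists, and every
det-twist of a dictionary splitting is again a dictionary splitting.  (The converse bookkeeping — that EVERY compatible splitting of
`U(𝕍)(𝔸)` is such a twist, i.e. that central characters of `U(𝕍)(𝔸)/U(𝕍)(L⁺)` factor through `det` — is NOT proved here.)

References: S. Gelbart, J. Rogawski, Invent. Math. 105 (1991), §3.1 Prop. 3.1.1 p. 455, Remark p. 457 L4–13 [GelbartRogawski1991];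
M. Harris, S. Kudla, W. J. Sweet, J. AMS 9 (1996), §1 (1.11)–(1.15), Cor. A.3 [HarrisKudlaSweet1996]; S. Kudla, Israel J. Math. 87 (1994),
§3 Thm. 3.1 [Kudla1994]; Y. Liu, Camb. J. Math. 9 (2021), App. D §D.1 Step 2 [Liu2021].
Provenance: pub-hodgecm2 cell (COR-CM, Hodge ladder stage 2), seat pin-3 (Δ2/X3 co-owner), X3-Char residual item (C).
HC_CM is NOT proved here or anywhere in the tree.
-/

set_option autoImplicit false

noncomputable section

open scoped Classical
open scoped Matrix Kronecker TensorProduct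
open NumberField IsDedekindDomain
open Literature.RepresentationTheory.HeisenbergGroup
open Literature.NumberTheory.Weil1964
open Literature.RepresentationTheory.HarrisKudlaSweet1996
open Literature.NumberTheory.Automorphic
open Literature.NumberTheory.GaloisRepresentations

namespace Literature.NumberTheory.Automorphic.Liu2021.Def411WeilCarriersDoubling

open Literature.NumberTheory.GelbartRogawski1991 Literature.NumberTheory.GelbartRogawski1991.UnitaryDualPair
open Literature.NumberTheory.GelbartRogawski1991.GRConstruction
open Literature.NumberTheory.GelbartRogawski1991.GRConstruction.DoubledWeilDetTwist

/-! ## §1 The determinant of the big unitary group of a pair, valued in `U(1)(𝔸)` -/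

section PairDet

variable (F E : Type) [Field F] [NumberField F] [Field E] [NumberField E] [Algebra F E]
variable (c : E ≃ₐ[F] E) (N M : ℕ) {n : ℕ} (e : Fin N × Fin M ≃ Fin n)
variable (JV : Matrix (Fin N) (Fin N) E) (JW : Matrix (Fin M) (Fin M) E)

/-- **`det : G₁(𝔸_F) = U(J_V ⊗ J_W)(𝔸_F) →* U(1)(𝔸_F)`** — the tree's `UnitaryGroup.adelicDet` of `U(reindex e e (J_V ⊗ J_W))`
pulled back along `adelicPairEmb` (`g ↦ reindex e e g`). [cite: GelbartRogawski1991, §3.1 Remark p. 457 L9–13] -/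
def pairDet (hJ : (Matrix.reindex e e (JV ⊗ₖ JW)).det ≠ 0) : UnitaryGroup.adelicPair F E c N M JV JW →* UnitaryGroup.adelicOne F E c :=
  (UnitaryGroup.adelicDet F E c n (Matrix.reindex e e (JV ⊗ₖ JW)) hJ).comp (UnitaryGroup.adelicPairEmb F E c N M e JV JW)

omit [NumberField F] in
/-- underlying adele of `pairDet g`: `det g`. [cite: GelbartRogawski1991, §3.1 Remark p. 457 L9–13] -/
theorem coe_coe_pairDet (hJ : (Matrix.reindex e e (JV ⊗ₖ JW)).det ≠ 0) (g : UnitaryGroup.adelicPair F E c N M JV JW) :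
    (((pairDet F E c N M e JV JW hJ g : UnitaryGroup.adelicOne F E c) : (AdeleRing (𝓞 E) E)ˣ) : AdeleRing (𝓞 E) E) =
      ((g : GL (Fin N × Fin M) (AdeleRing (𝓞 E) E)) : Matrix (Fin N × Fin M) (Fin N × Fin M) (AdeleRing (𝓞 E) E)).det := by
  change (((UnitaryGroup.adelicPairEmb F E c N M e JV JW g : UnitaryGroup.adelic F E c n (Matrix.reindex e e (JV ⊗ₖ JW))) :
      GL (Fin n) (AdeleRing (𝓞 E) E)) : Matrix (Fin n) (Fin n) (AdeleRing (𝓞 E) E)).det = _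
  rw [UnitaryGroup.coe_adelicPairEmb, UnitaryGroup.coe_reindexGL, Matrix.det_reindex_self]

/-- **transport of a det-twist along equal W-side Gram data**: `splittingCongr` commutes with twisting by `α ∘ det`.
[cite: GelbartRogawski1991, §3.1 Remark p. 457 L4–13] -/
theorem splittingCongr_twist_pairDet {TV : Matrix (Fin N) (Fin N) F} {TW TW' : Matrix (Fin M) (Fin M) F}
    {JW' : Matrix (Fin M) (Fin M) E} (hT : TW = TW') (hJ : JW = JW')
    (hd : (Matrix.reindex e e (JV ⊗ₖ JW)).det ≠ 0) (hd' : (Matrix.reindex e e (JV ⊗ₖ JW')).det ≠ 0)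
    (s : UnitaryGroup.adelicPair F E c N M JV JW →* adelicMpCont F (Fin n) (adelicGram F e TV TW))
    (α : UnitaryGroup.adelicOne F E c →* ℂˣ) :
    splittingCongr F E c N M e JV hT hJ (adelicMpCont.twist F (Fin n) (adelicGram F e TV TW) s (α.comp (pairDet F E c N M e JV JW hd))) =
      adelicMpCont.twist F (Fin n) (adelicGram F e TV TW') (splittingCongr F E c N M e JV hT hJ s)
        (α.comp (pairDet F E c N M e JV JW' hd')) := by
  subst hT hJ
  rfl

end PairDet

/-! ## §2 `ι_{χ·α̃} = ι_χ ⊗ (α ∘ det)` for the lane's datum `(diag dV, diag dW)` -/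

variable (L : Type) [Field L] [NumberField L] [IsCMField L]

variable {N M n : ℕ} (e : Fin N × Fin M ≃ Fin n)
  (dV : Fin N → L) (hdV : ∀ i, IsCMField.complexConj L (dV i) = dV i) (hdV0 : ∀ i, dV i ≠ 0)
  (dW : Fin M → L) (hdW : ∀ i, IsCMField.complexConj L (dW i) = dW i) (hdW0 : ∀ i, dW i ≠ 0)

variable {α : UnitaryGroup.adelicOne (Fp L) L (IsCMField.complexConj L) →* ℂˣ}

omit [NumberField L] [IsCMField L] in
include hdV0 hdW0 in
/-- `det (reindex e e (diag dV ⊗ diag dW)) ≠ 0`. [cite: GelbartRogawski1991, §3.1 Prop. 3.1.1 p. 455 L1–2] -/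
theorem det_reindex_kronecker_diagonal_ne_zero :
    (Matrix.reindex e e (Matrix.diagonal dV ⊗ₖ Matrix.diagonal dW)).det ≠ 0 := by
  rw [Matrix.det_reindex_self, Matrix.det_kronecker, Matrix.det_diagonal, Matrix.det_diagonal]
  exact mul_ne_zero (pow_ne_zero _ (Finset.prod_ne_zero_iff.2 fun i _ => hdV0 i))
    (pow_ne_zero _ (Finset.prod_ne_zero_iff.2 fun i _ => hdW0 i))

include hdV0 hdW0 in
/-- **`(α ∘ det_H) ∘ inlG = α ∘ det` on `G₁(𝔸)`** (`det (g ⊕ 1) = det g`, `coe_detH_inlG`).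
[cite: GelbartRogawski1991, §3.1 Remark p. 457 L9–13] [cite: Kudla1994, §3] -/
theorem detChar_comp_inlG (α : UnitaryGroup.adelicOne (Fp L) L (IsCMField.complexConj L) →* ℂˣ) :
    (DoubledWeilDetTwist.detChar L e dV hdV hdV0 dW hdW hdW0 α).comp (inlG L e dV hdV dW hdW) =
      α.comp (pairDet (Fp L) L (IsCMField.complexConj L) N M e (Matrix.diagonal dV) (Matrix.diagonal dW)
        (det_reindex_kronecker_diagonal_ne_zero L e dV hdV0 dW hdW0)) := by
  refine MonoidHom.ext fun g => congrArg α (Subtype.ext (Units.ext ?_))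
  exact (coe_detH_inlG L e dV hdV hdV0 dW hdW hdW0 g).trans
    (coe_coe_pairDet (Fp L) L (IsCMField.complexConj L) N M e (Matrix.diagonal dV) (Matrix.diagonal dW) _ g).symm

include hdV0 hdW0 in
set_option maxHeartbeats 800000 in
-- (`chiSplitting χ` unfolds to `undoubleHom (doubledWeilRep χ) _` by `rfl` inside the final `congrArg`)
/-- **`ι_{χ·α̃} = ι_χ ⊗ (α ∘ det)`.**  For `χ` unitary with `χ|_{𝕀_{L⁺}} = ε` and `α` a continuous unitary automorphic character of
`U(1)(𝔸_{L⁺})`, the compatible splitting attached to `χ' = χ · α̃` by doubling is the twist of the one attached to `χ` by the central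
character `α ∘ det` of `G₁(𝔸) = U(𝕍)(𝔸_{L⁺})`: the `χ'`-normalised doubled Weil representation is `s^𝔻_χ ⊗ (α ∘ det_H)`
(`IsDoubledWeilRep.detTwist`, uniqueness), undoubling commutes with the twist (`undoubleHom_twist`) and `det_H(g ⊕ 1) = det g`.
[cite: GelbartRogawski1991, §3.1 Remark p. 457 L4–13] [cite: HarrisKudlaSweet1996, §1 (1.14)–(1.15), Cor. A.3 p. 998] [cite: Kudla1994, §3 Thm. 3.1] -/
theorem chiSplitting_mul_ratioHecke (χ : HeckeCharacter L) (hχu : χ.IsUnitary) (hχs : IsSplittingChar L 1 χ)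
    (hα : Continuous α)
    (hαrat : ∀ u : UnitaryGroup.adelicOne (Fp L) L (IsCMField.complexConj L), (u : ideleGroup L) ∈ principalIdeles L → α u = 1)
    (hαu : ∀ u, ‖((α u : ℂˣ) : ℂ)‖ = 1) :
    chiSplitting L e dV hdV hdV0 dW hdW hdW0 (χ * ratioHecke L α hα hαrat) (isUnitary_mul_ratioHecke L hχu hα hαrat hαu)
        ((isSplittingChar_mul_ratioHecke_iff L 1 χ hα hαrat).2 hχs) =
      adelicMpCont.twist (Fp L) (Fin n) (gramA L e dV hdV dW hdW) (chiSplitting L e dV hdV hdV0 dW hdW hdW0 χ hχu hχs)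
        (α.comp (pairDet (Fp L) L (IsCMField.complexConj L) N M e (Matrix.diagonal dV) (Matrix.diagonal dW)
          (det_reindex_kronecker_diagonal_ne_zero L e dV hdV0 dW hdW0))) := by
  have h := (isDoubledWeilRep_doubledWeilRep L e dV hdV hdV0 dW hdW hdW0 χ hχu hχs).detTwist L e dV hdV hdV0 dW hdW hdW0 α hα
    (mul_ratioHecke_apply L χ hα hαrat)
  exact (chiSplitting_eq_undoubleHom L e dV hdV hdV0 dW hdW hdW0 _ _ _ h).trans
    ((undoubleHom_twist L e dV hdV hdV0 dW hdW hdW0 _ _).trans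
      (congrArg (adelicMpCont.twist (Fp L) (Fin n) (gramA L e dV hdV dW hdW) (chiSplitting L e dV hdV hdV0 dW hdW hdW0 χ hχu hχs))
        (detChar_comp_inlG L e dV hdV hdV0 dW hdW hdW0 α)))

/-! ## §3 The same at the hermitian line `⟨T_W⟩` -/

variable {N' n' : ℕ} (e₁ : Fin N' × Fin 1 ≃ Fin n')
  (dV₁ : Fin N' → L) (hdV₁ : ∀ i, IsCMField.complexConj L (dV₁ i) = dV₁ i) (hdV₁0 : ∀ i, dV₁ i ≠ 0)

omit [NumberField L] [IsCMField L] in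
include hdV₁0 in
/-- `det (reindex e (diag dV ⊗ J_W)) ≠ 0` for the line `J_W = T_W ⊗ L`, `det T_W` a unit. [cite: Liu2021, App. D §D.1 Step 1 (l. 5217)] -/
theorem det_reindex_kronecker_diagonal_line_ne_zero (TW : Matrix (Fin 1) (Fin 1) (Fp L)) (hWd : IsUnit TW.det)
    (JW : Matrix (Fin 1) (Fin 1) L) (hJW : JW = TW.map (algebraMap (Fp L) L)) :
    (Matrix.reindex e₁ e₁ (Matrix.diagonal dV₁ ⊗ₖ JW)).det ≠ 0 := by
  rw [Matrix.det_reindex_self, Matrix.det_kronecker, Matrix.det_diagonal, hJW, ← RingHom.mapMatrix_apply, ← RingHom.map_det]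
  exact mul_ne_zero (pow_ne_zero _ (Finset.prod_ne_zero_iff.2 fun i _ => hdV₁0 i)) (pow_ne_zero _ ((hWd.map _).ne_zero))

include hdV₁0 in
set_option maxHeartbeats 2000000 in
-- (one pass through the `splittingDatum` telescope of `chiSplittingLine`, as in `Def411WeilCarriersDoublingUnique`)
/-- **`ι_{χ·α̃} = ι_χ ⊗ (α ∘ det)` at the hermitian line `⟨T_W⟩`**: the splitting attached to `χ' = χ · α̃` at the line datum over
`(diag dV, J_W)` is the twist of the one attached to `χ` by `α ∘ det`, `det : U(diag dV ⊗ J_W)(𝔸_{L⁺}) →* U(1)(𝔸_{L⁺})` (`pairDet`).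
At `χ := μ` this reads: [Liu2021, App. D Step 2]'s `ι_{μ·α̃}` is `ι_μ ⊗ (α ∘ det)`.
[cite: Liu2021, App. D §D.1 Step 2 (l. 5219)] [cite: GelbartRogawski1991, §3.1 Remark p. 457 L4–13] [cite: HarrisKudlaSweet1996, §1 (1.14)–(1.15), Cor. A.3 p. 998] -/
theorem chiSplittingLine_mul_ratioHecke (χ : HeckeCharacter L) (hχu : χ.IsUnitary) (hχs : IsSplittingChar L 1 χ)
    (hα : Continuous α)
    (hαrat : ∀ u : UnitaryGroup.adelicOne (Fp L) L (IsCMField.complexConj L), (u : ideleGroup L) ∈ principalIdeles L → α u = 1)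
    (hαu : ∀ u, ‖((α u : ℂˣ) : ℂ)‖ = 1)
    (TW : Matrix (Fin 1) (Fin 1) (Fp L)) (hWd : IsUnit TW.det) (JW : Matrix (Fin 1) (Fin 1) L) (hJW : JW = TW.map (algebraMap (Fp L) L)) :
    chiSplittingLine L e₁ dV₁ hdV₁ hdV₁0 (χ * ratioHecke L α hα hαrat) (isUnitary_mul_ratioHecke L hχu hα hαrat hαu)
        ((isSplittingChar_mul_ratioHecke_iff L 1 χ hα hαrat).2 hχs) TW hWd JW hJW =
      adelicMpCont.twist (Fp L) (Fin n') (adelicGram (Fp L) e₁ (realDiagonal L dV₁ hdV₁) TW)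
        (chiSplittingLine L e₁ dV₁ hdV₁ hdV₁0 χ hχu hχs TW hWd JW hJW)
        (α.comp (pairDet (Fp L) L (IsCMField.complexConj L) N' 1 e₁ (Matrix.diagonal dV₁) JW
          (det_reindex_kronecker_diagonal_line_ne_zero L e₁ dV₁ hdV₁0 TW hWd JW hJW))) := by
  unfold chiSplittingLine
  rw [chiSplitting_mul_ratioHecke L e₁ dV₁ hdV₁ hdV₁0 (lineW L TW) (complexConj_lineW L TW) (lineW_ne_zero L TW hWd) χ hχu hχs
    hα hαrat hαu]
  exact splittingCongr_twist_pairDet (Fp L) L (IsCMField.complexConj L) N' 1 e₁ (Matrix.diagonal dV₁)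
    (Matrix.diagonal (lineW L TW)) (realDiagonal_lineW L TW) (diagonal_lineW L TW hJW) _ _ _ α

end Literature.NumberTheory.Automorphic.Liu2021.Def411WeilCarriersDoubling

end
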